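import Summits.AtomisticToContinuum.BoseEinsteinCondensation.Theses.BECStronglyRayleigh
import Literature.Combinatorics.StablePolynomials.Limits
import Literature.Combinatorics.StablePolynomials.ElementarySymmetric
import Literature.MathematicalPhysics.QuantumLattice.PerronFrobeniusGroundState

/-!
# Ideator sketch (crux-ideate round 1, ideator 3) for crux `BECStronglyRayleigh.GroundStateStability`
(item stmt-AtomisticToContinuum-9672)

Two levers, first lemmas only (statements; proofs attempted where cheap).

* Card `wedge-kkt-selection` — **the Lie wedge as a variational inequality.**
  `wedgeKKT_selection` (abstract, real, finite-dimensional): if `H = Σ_k T_k` with symmetric `T_k`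
  and a closed cone `K ∌` only `0` is mapped into itself by every Euler gate `1 - ε T_k`
  (`0 ≤ ε ≤ ε₀`), then a minimiser of the Rayleigh quotient of `H` over `K ∖ {0}` exists and is an
  EIGENVECTOR of `H`:  `b_k := ⟨T_k v, (H-λ)v⟩ ≤ 0` for each `k` by one-sided first-order optimality,
  and `Σ_k b_k = ‖(H-λ)v‖²`.  Instantiated with the stable nonnegative cone of a magnetisation sector
  and the XXZ bond/site Euler gates (`EulerGatesAdmissible`, = Stub A of the picked line + diagonal
  scaling) it yields `ConeMinimiserIsEigen`, whence the crux by sector Perron–Frobenius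
  (`crux_of_kkt`).  No matrix exponential, no Lie–Trotter, no PSD / spectral mapping, no `τ`.
* Card `lyapunov-inertia-window` — **N = 2 by a Lyapunov equation.** `lyapunovIdentity_N2`:
  the two-particle amplitude matrix solves `B K + K B = Δ (A ⊙ K) - diag((A ⊙ K) 1)`;
  `window_psd`: `diag(W 1) - Δ W ⪰ 0` for every entrywise-nonnegative symmetric `W` iff `|Δ| ≤ 1`
  (Laplacian ↔ signless Laplacian) — the window; `inertia_compression`: positive index of `K` is at
  most the number of non-positive directions of `B`.
-/

namespace Summit.AtomisticToContinuum.BoseEinsteinCondensation.Cruxes.GroundStateStability.IdeatorK3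

open scoped BigOperators Matrix
open Literature.MathematicalPhysics.QuantumLattice

/-! ## Card 1 — `wedge-kkt-selection` -/

section Abstract

variable {m : Type} [Fintype m] [DecidableEq m] {ι : Type} [Fintype ι]

/-- **Abstract KKT selection lemma (the lever).** `H = Σ_k T_k`, each `T_k` symmetric; `K` a closed
cone (closed under positive scaling) containing a nonzero vector, and for every `k` and every
`v ∈ K` the Euler gate `v - ε T_k v` stays in `K` for all small `ε ≥ 0`.  Then some `v ∈ K ∖ {0}`
minimises the Rayleigh quotient of `H` on `K ∖ {0}`, and EVERY such minimiser is an eigenvector: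
with `λ = ⟨v,Hv⟩/⟨v,v⟩`, `g_k(ε) = ⟨(1-εT_k)v, (H-λ)(1-εT_k)v⟩ ≥ 0` on `[0, ε₀]` and `g_k(0) = 0`
give `b_k = ⟨T_k v,(H-λ)v⟩ ≤ 0`; summing, `Σ_k b_k = ⟨Hv,(H-λ)v⟩ = ‖(H-λ)v‖² ≤ 0`. -/
theorem dotProduct_mulVec_of_isSymm (A : Matrix m m ℝ) (hA : A.IsSymm) (v w : m → ℝ) :
    v ⬝ᵥ (A *ᵥ w) = (A *ᵥ v) ⬝ᵥ w := by
  rw [Matrix.dotProduct_mulVec, ← Matrix.vecMul_transpose, hA.eq]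

/-- The purely algebraic heart of `wedgeKKT_selection`, isolated: if `v` is a Rayleigh-quotient
value-`lam` vector (`⟨v,(H-lam)v⟩ = 0`) and every term satisfies the one-sided first-order condition
`⟨T_k v, (H - lam) v⟩ ≤ 0`, then `(H - lam) v = 0`. -/
theorem eigen_of_termwise_firstOrder'
    (T : ι → Matrix m m ℝ) (v : m → ℝ) (lam : ℝ)
    (hlam : v ⬝ᵥ ((∑ k, T k) *ᵥ v - lam • v) = 0)
    (hfo : ∀ k, (T k *ᵥ v) ⬝ᵥ ((∑ k, T k) *ᵥ v - lam • v) ≤ 0) :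
    (∑ k, T k) *ᵥ v = lam • v := by
  set r : m → ℝ := (∑ k, T k) *ᵥ v - lam • v with hr
  have hsum : ((∑ k, T k) *ᵥ v) ⬝ᵥ r = ∑ k, (T k *ᵥ v) ⬝ᵥ r := by
    rw [Matrix.sum_mulVec, sum_dotProduct]
  have h1 : ((∑ k, T k) *ᵥ v) ⬝ᵥ r ≤ 0 := by
    rw [hsum]; exact Finset.sum_nonpos fun k _ => hfo k
  have h2 : r ⬝ᵥ r = ((∑ k, T k) *ᵥ v) ⬝ᵥ r - lam * (v ⬝ᵥ r) := by
    rw [hr, sub_dotProduct, smul_dotProduct, smul_eq_mul]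
  have h3 : v ⬝ᵥ r = 0 := hlam
  have h4 : r ⬝ᵥ r ≤ 0 := by rw [h2, h3, mul_zero, sub_zero]; exact h1
  have h0 : 0 ≤ r ⬝ᵥ r := Finset.sum_nonneg fun i _ => mul_self_nonneg (r i)
  have h5 : r = 0 := dotProduct_self_eq_zero.mp (le_antisymm h4 h0)
  exact sub_eq_zero.mp h5

/-- **Abstract KKT selection lemma (the lever) — PROVED.** `H = Σ_k T_k`, each `T_k` symmetric; `K` a
closed cone (closed under positive scaling) containing a nonzero vector, and for every `k` and every
`v ∈ K` the Euler gate `v - ε T_k v` stays in `K` for all small `ε ≥ 0`.  Then some `v ∈ K ∖ {0}`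
minimises the Rayleigh quotient of `H` on `K ∖ {0}`, and such a minimiser is an eigenvector:
with `λ = ⟨v,Hv⟩/⟨v,v⟩`, `q(w) = ⟨w,Hw⟩ - λ⟨w,w⟩ ≥ 0` on `K`, `q(v) = 0`, and
`q(v - εT_k v) = -2ε b_k + ε² q(T_k v)` give `b_k = ⟨T_k v,(H-λ)v⟩ ≤ 0`; summing,
`Σ_k b_k = ⟨Hv,(H-λ)v⟩ = ‖(H-λ)v‖² ≤ 0` (`eigen_of_termwise_firstOrder'`). -/
theorem wedgeKKT_selection
    (T : ι → Matrix m m ℝ) (hT : ∀ k, (T k).IsSymm)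
    (K : Set (m → ℝ)) (hKc : IsClosed K) (hK0 : ∃ v ∈ K, v ≠ 0)
    (hKcone : ∀ c : ℝ, 0 < c → ∀ v ∈ K, c • v ∈ K)
    (hKinv : ∀ k, ∀ v ∈ K, ∃ ε₀ : ℝ, 0 < ε₀ ∧ ∀ ε : ℝ, 0 ≤ ε → ε ≤ ε₀ → v - ε • (T k *ᵥ v) ∈ K) :
    ∃ v ∈ K, v ≠ 0 ∧ ∃ lam : ℝ, (∑ k, T k) *ᵥ v = lam • v ∧
      ∀ w ∈ K, w ≠ 0 → lam * (w ⬝ᵥ w) ≤ w ⬝ᵥ ((∑ k, T k) *ᵥ w) := by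
  classical
  set H : Matrix m m ℝ := ∑ k, T k with hHdef
  have hH : H.IsSymm := by
    rw [hHdef]; unfold Matrix.IsSymm; rw [Matrix.transpose_sum]
    exact Finset.sum_congr rfl (fun k _ => (hT k).eq)
  -- quadratic forms and their continuity / positivity / scaling
  have hQc : Continuous fun w : m → ℝ => w ⬝ᵥ (H *ᵥ w) := by
    simp only [dotProduct, Matrix.mulVec]; fun_prop
  have hNc : Continuous fun w : m → ℝ => w ⬝ᵥ w := by
    simp only [dotProduct]; fun_prop
  have hNpos : ∀ w : m → ℝ, w ≠ 0 → 0 < w ⬝ᵥ w := by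
    intro w hw
    have h0 : 0 ≤ w ⬝ᵥ w := Finset.sum_nonneg fun i _ => mul_self_nonneg (w i)
    rcases h0.lt_or_eq with h | h
    · exact h
    · exact absurd (dotProduct_self_eq_zero.mp h.symm) hw
  have hQs : ∀ (c : ℝ) (w : m → ℝ), (c • w) ⬝ᵥ (H *ᵥ (c • w)) = c * c * (w ⬝ᵥ (H *ᵥ w)) := by
    intro c w
    simp only [Matrix.mulVec_smul, smul_dotProduct, dotProduct_smul, smul_eq_mul]; ring
  have hNs : ∀ (c : ℝ) (w : m → ℝ), (c • w) ⬝ᵥ (c • w) = c * c * (w ⬝ᵥ w) := by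
    intro c w
    simp only [smul_dotProduct, dotProduct_smul, smul_eq_mul]; ring
  -- the compact slice `K ∩ sphere`
  set S : Set (m → ℝ) := K ∩ Metric.sphere (0 : m → ℝ) 1 with hSdef
  have hSc : IsCompact S := (isCompact_sphere (0 : m → ℝ) 1).inter_left hKc
  obtain ⟨v0, hv0K, hv0⟩ := hK0
  have hnorm : ∀ w : m → ℝ, w ≠ 0 → ‖w‖⁻¹ • w ∈ Metric.sphere (0 : m → ℝ) 1 := by
    intro w hw
    rw [mem_sphere_zero_iff_norm, norm_smul, norm_inv, norm_norm,
      inv_mul_cancel₀ (norm_ne_zero_iff.mpr hw)]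
  have hSne : S.Nonempty :=
    ⟨‖v0‖⁻¹ • v0, hKcone _ (inv_pos.mpr (norm_pos_iff.mpr hv0)) v0 hv0K, hnorm v0 hv0⟩
  have hS0 : ∀ w ∈ S, w ≠ 0 := by
    intro w hw h0
    have h1 := hw.2
    rw [h0, mem_sphere_zero_iff_norm, norm_zero] at h1
    exact zero_ne_one h1
  set f : (m → ℝ) → ℝ := fun w => (w ⬝ᵥ (H *ᵥ w)) / (w ⬝ᵥ w) with hfdef
  have hfc : ContinuousOn f S := by
    refine (hQc.continuousOn).div hNc.continuousOn ?_
    intro w hw; exact (hNpos w (hS0 w hw)).ne'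
  obtain ⟨v, hvS, hvmin⟩ := hSc.exists_isMinOn hSne hfc
  have hv0' : v ≠ 0 := hS0 v hvS
  have hvK : v ∈ K := hvS.1
  set lam : ℝ := f v with hlamdef
  -- minimality over the whole cone (scale invariance of `f`)
  have hmin : ∀ w ∈ K, w ≠ 0 → lam ≤ f w := by
    intro w hwK hw
    have hw' : ‖w‖⁻¹ • w ∈ S := ⟨hKcone _ (inv_pos.mpr (norm_pos_iff.mpr hw)) w hwK, hnorm w hw⟩
    have hc : (‖w‖⁻¹ * ‖w‖⁻¹) ≠ 0 := by
      have : ‖w‖ ≠ 0 := norm_ne_zero_iff.mpr hw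
      positivity
    have h1 : f (‖w‖⁻¹ • w) = f w := by
      show ((‖w‖⁻¹ • w) ⬝ᵥ (H *ᵥ (‖w‖⁻¹ • w))) / ((‖w‖⁻¹ • w) ⬝ᵥ (‖w‖⁻¹ • w)) =
        (w ⬝ᵥ (H *ᵥ w)) / (w ⬝ᵥ w)
      rw [hQs, hNs, mul_div_mul_left _ _ hc]
    have h2 : f v ≤ f (‖w‖⁻¹ • w) := hvmin hw'
    rw [h1] at h2
    exact h2
  -- `q(w) = ⟨w,Hw⟩ - lam ⟨w,w⟩ ≥ 0` on `K`, `= 0` at `v`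
  have hq_nonneg : ∀ w ∈ K, 0 ≤ w ⬝ᵥ (H *ᵥ w) - lam * (w ⬝ᵥ w) := by
    intro w hwK
    by_cases hw : w = 0
    · subst hw; simp
    · have hN := hNpos w hw
      have h1 : lam ≤ (w ⬝ᵥ (H *ᵥ w)) / (w ⬝ᵥ w) := hmin w hwK hw
      rw [le_div_iff₀ hN] at h1
      linarith
  have hqv : v ⬝ᵥ (H *ᵥ v) - lam * (v ⬝ᵥ v) = 0 := by
    have hN := hNpos v hv0'
    have h1 : lam = (v ⬝ᵥ (H *ᵥ v)) / (v ⬝ᵥ v) := rfl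
    rw [h1, div_mul_cancel₀ _ hN.ne']
    ring
  -- one-sided first-order conditions, term by term
  have hfo : ∀ k, (T k *ᵥ v) ⬝ᵥ (H *ᵥ v - lam • v) ≤ 0 := by
    intro k
    obtain ⟨ε₀, hε₀, hgate⟩ := hKinv k v hvK
    set t : m → ℝ := T k *ᵥ v with htdef
    have hsym : v ⬝ᵥ (H *ᵥ t) = t ⬝ᵥ (H *ᵥ v) := by
      rw [dotProduct_mulVec_of_isSymm H hH v t, dotProduct_comm]
    have hvt : v ⬝ᵥ t = t ⬝ᵥ v := dotProduct_comm _ _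
    -- expansion of `q(v - ε t)`
    have hexp : ∀ ε : ℝ,
        (v - ε • t) ⬝ᵥ (H *ᵥ (v - ε • t)) - lam * ((v - ε • t) ⬝ᵥ (v - ε • t)) =
          (v ⬝ᵥ (H *ᵥ v) - lam * (v ⬝ᵥ v)) - 2 * ε * (t ⬝ᵥ (H *ᵥ v - lam • v))
            + ε ^ 2 * (t ⬝ᵥ (H *ᵥ t) - lam * (t ⬝ᵥ t)) := by
      intro ε
      simp only [Matrix.mulVec_sub, Matrix.mulVec_smul, sub_dotProduct, dotProduct_sub,
        smul_dotProduct, dotProduct_smul, smul_eq_mul, hsym, hvt]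
      ring
    by_contra hb
    push Not at hb
    set b : ℝ := t ⬝ᵥ (H *ᵥ v - lam • v) with hbdef
    set cq : ℝ := t ⬝ᵥ (H *ᵥ t) - lam * (t ⬝ᵥ t) with hcqdef
    set ε : ℝ := min ε₀ (b / (|cq| + 1)) with hεdef
    have hden : 0 < |cq| + 1 := by positivity
    have hεpos : 0 < ε := lt_min hε₀ (div_pos hb hden)
    have hεle : ε ≤ ε₀ := min_le_left _ _
    have hεle2 : ε ≤ b / (|cq| + 1) := min_le_right _ _
    have hmem : v - ε • t ∈ K := hgate ε hεpos.le hεle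
    have h1 := hq_nonneg _ hmem
    rw [hexp ε, hqv] at h1
    have h2 : ε ^ 2 * cq ≤ ε * b * (|cq| / (|cq| + 1)) := by
      have h21 : ε ^ 2 * cq ≤ ε ^ 2 * |cq| :=
        mul_le_mul_of_nonneg_left (le_abs_self cq) (sq_nonneg ε)
      calc ε ^ 2 * cq ≤ ε ^ 2 * |cq| := h21
        _ = ε * (ε * |cq|) := by ring
        _ ≤ ε * (b / (|cq| + 1) * |cq|) := by
            apply mul_le_mul_of_nonneg_left _ hεpos.le
            exact mul_le_mul_of_nonneg_right hεle2 (abs_nonneg _)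
        _ = ε * b * (|cq| / (|cq| + 1)) := by ring
    have h3 : |cq| / (|cq| + 1) < 1 := by
      rw [div_lt_one hden]; linarith
    have h4 : ε * b * (|cq| / (|cq| + 1)) < ε * b * 1 :=
      mul_lt_mul_of_pos_left h3 (mul_pos hεpos hb)
    nlinarith
  -- conclusion
  have heig : H *ᵥ v = lam • v := by
    apply eigen_of_termwise_firstOrder' T v lam
    · show v ⬝ᵥ (H *ᵥ v - lam • v) = 0
      rw [dotProduct_sub, dotProduct_smul, smul_eq_mul]
      exact hqv
    · exact hfo
  refine ⟨v, hvK, hv0', lam, heig, ?_⟩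
  intro w hwK hw
  have h1 : lam ≤ (w ⬝ᵥ (H *ᵥ w)) / (w ⬝ᵥ w) := hmin w hwK hw
  rw [le_div_iff₀ (hNpos w hw)] at h1
  exact h1

end Abstract

section XXZ

variable (Λ : Type) [Fintype Λ] [DecidableEq Λ]

/-- The occupation polynomial `Σ_S φ(1_S) ∏_{x∈S} z_x` of a coefficient vector is `H^Λ`-stable
(written inline exactly as in the crux). -/
def OccStable (φ : TensorIndex Λ 2 → ℂ) : Prop :=
  ∀ z : Λ → ℂ, (∀ i, 0 < (z i).im) →
    (∑ S : Finset Λ, φ (fun i => if i ∈ S then 0 else 1) * ∏ i ∈ S, z i) ≠ 0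

/-- Entrywise real and nonnegative. -/
def RealNonneg (φ : TensorIndex Λ 2 → ℂ) : Prop :=
  ∀ σ : TensorIndex Λ 2, 0 ≤ (φ σ).re ∧ (φ σ).im = 0

/-- The stable nonnegative cone of the sector `M` (without `0`). -/
def StableCone (M : ℝ) (φ : TensorIndex Λ 2 → ℂ) : Prop :=
  φ ∈ spinZSector 1 M ∧ RealNonneg Λ φ ∧ OccStable Λ φ

/-- **Admissibility of the Euler gates** on the stable nonnegative cone of sector `M`
(hypothesis of the instance; for the bond gates this is Stub A `stub_eulerGate` of the picked line
restricted to nonnegative inputs, the sector and sign conditions being automatic; the site gates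
`1 - ε μ_x S³_x` are positive diagonal rescalings of `z_x`, `IsUpperHalfPlaneStable.diagScale`).
By LINEARITY of the first-order conditions in the Hamiltonian term and
`h_b(Δ) = ((1+Δ)/2) h_b(1) + ((1-Δ)/2) h_b(-1)`, it would even suffice to have the bond clause at
`Δ = 1` (SSEP gate `(1-ε/4)·1 + (ε/2)·swap`) and `Δ = -1` (anti-swap gate, six-vertex weights
`(1-ε/4, 1+ε/4, ε/2)`). -/
def EulerGatesAdmissible (G : SimpleGraph Λ) [DecidableRel G.Adj] (Δ : ℝ) (μ : Λ → ℝ) (M : ℝ) : Prop :=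
  (∀ x y : Λ, G.Adj x y → ∀ ε : ℝ, 0 ≤ ε → ε ≤ 1 → ∀ φ : TensorIndex Λ 2 → ℂ, StableCone Λ M φ →
      (1 + (ε : ℂ) • (spinBond 1 0 x y + spinBond 1 1 x y + (Δ : ℂ) • spinBond 1 2 x y)) *ᵥ φ = 0 ∨
      StableCone Λ M ((1 + (ε : ℂ) • (spinBond 1 0 x y + spinBond 1 1 x y + (Δ : ℂ) • spinBond 1 2 x y)) *ᵥ φ)) ∧
  (∀ x : Λ, ∀ ε : ℝ, |ε * μ x| < 2 → ∀ φ : TensorIndex Λ 2 → ℂ, StableCone Λ M φ →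
      StableCone Λ M ((1 - (ε : ℂ) • (((μ x : ℝ) : ℂ) • siteSpin 1 x 2)) *ᵥ φ))

/-- **Conclusion of the instance**: the stable nonnegative cone of a nonempty sector contains an
eigenvector of `H = xxzHamiltonian 1 G (-1) Δ + Σ_x μ_x S³_x` (in fact the minimiser of the energy
over the cone). -/
def ConeMinimiserIsEigen (G : SimpleGraph Λ) [DecidableRel G.Adj] (Δ : ℝ) (μ : Λ → ℝ) (M : ℝ) : Prop :=
  (∃ ψ : TensorIndex Λ 2 → ℂ, ψ ∈ spinZSector 1 M ∧ ψ ≠ 0) →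
    ∃ φ : TensorIndex Λ 2 → ℂ, StableCone Λ M φ ∧ φ ≠ 0 ∧ ∃ E : ℝ,
      (xxzHamiltonian 1 G (-1) Δ + ∑ x : Λ, ((μ x : ℝ) : ℂ) • siteSpin 1 x 2) *ᵥ φ = (E : ℂ) • φ

/-- **First lemma of card `wedge-kkt-selection` (XXZ instance, M-sized stub).** Realify the sector
(`H` has real matrix elements and commutes with `S³_tot`), take `K` = closure-free stable nonnegative
cone ∪ {0} (closed by Hurwitz in coefficient form `eq_zero_or_isUpperHalfPlaneStable_of_tendsto_coeff`,
nonzero because the `e_N` vector is in it, `isUpperHalfPlaneStable_esymm`), `T_k` = the bond terms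
`-(S¹S¹+S²S²+ΔS³S³)_b` over `G.edgeFinset` and the site terms `μ_x S³_x`; `EulerGatesAdmissible` is
exactly the gate-invariance hypothesis of `wedgeKKT_selection`. -/
theorem coneMinimiserIsEigen_of_admissible (G : SimpleGraph Λ) [DecidableRel G.Adj]
    (Δ : ℝ) (μ : Λ → ℝ) (M : ℝ) (hadm : EulerGatesAdmissible Λ G Δ μ M) :
    ConeMinimiserIsEigen Λ G Δ μ M := by
  sorry

/-- **Composition to the crux** (glue, by sector Perron–Frobenius = Stub F of the picked line, here a
hypothesis `hPF`: uniqueness of the sector ground ray and "a nonzero nonnegative sector eigenvector has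
the lowest sector energy"). -/
theorem crux_of_kkt
    (hK : ∀ (Λ : Type) [Fintype Λ] [DecidableEq Λ] (G : SimpleGraph Λ) [DecidableRel G.Adj],
      G.Connected → ∀ (Δ : ℝ) (μ : Λ → ℝ), |Δ| ≤ 1 → ∀ M : ℝ, ConeMinimiserIsEigen Λ G Δ μ M)
    (hPF : ∀ (Λ : Type) [Fintype Λ] [DecidableEq Λ] (G : SimpleGraph Λ) [DecidableRel G.Adj], G.Connected →
      ∀ (Δ : ℝ) (μ : Λ → ℝ) (M : ℝ) (ψ : TensorIndex Λ 2 → ℂ), ψ ∈ spinZSector 1 M → ψ ≠ 0 →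
      (xxzHamiltonian 1 G (-1) Δ + ∑ x : Λ, ((μ x : ℝ) : ℂ) • siteSpin 1 x 2) *ᵥ ψ = ((lowestEnergyInSector 1 (xxzHamiltonian 1 G (-1) Δ + ∑ x : Λ, ((μ x : ℝ) : ℂ) • siteSpin 1 x 2) M : ℝ) : ℂ) • ψ →
      (∀ φ : TensorIndex Λ 2 → ℂ, φ ∈ spinZSector 1 M →
        (xxzHamiltonian 1 G (-1) Δ + ∑ x : Λ, ((μ x : ℝ) : ℂ) • siteSpin 1 x 2) *ᵥ φ = ((lowestEnergyInSector 1 (xxzHamiltonian 1 G (-1) Δ + ∑ x : Λ, ((μ x : ℝ) : ℂ) • siteSpin 1 x 2) M : ℝ) : ℂ) • φ →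
        ∃ c : ℂ, φ = c • ψ) ∧
      (∀ (φ : TensorIndex Λ 2 → ℂ) (E : ℂ), φ ∈ spinZSector 1 M →
        (∀ σ : TensorIndex Λ 2, 0 ≤ (φ σ).re ∧ (φ σ).im = 0) → φ ≠ 0 →
        (xxzHamiltonian 1 G (-1) Δ + ∑ x : Λ, ((μ x : ℝ) : ℂ) • siteSpin 1 x 2) *ᵥ φ = E • φ → E = ((lowestEnergyInSector 1 (xxzHamiltonian 1 G (-1) Δ + ∑ x : Λ, ((μ x : ℝ) : ℂ) • siteSpin 1 x 2) M : ℝ) : ℂ))) :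
    Summit.AtomisticToContinuum.BoseEinsteinCondensation.Theses.BECStronglyRayleigh.GroundStateStability := by
  sorry

end XXZ

/-! ## Card 2 — `lyapunov-inertia-window` (N = 2) -/

section Inertia

variable {n : Type} [Fintype n] [DecidableEq n]

omit [DecidableEq n] in
theorem dot_mulVec_eq_sum (M : Matrix n n ℝ) (v : n → ℝ) :
    v ⬝ᵥ (M *ᵥ v) = ∑ i, ∑ j, M i j * (v i * v j) := by
  simp only [dotProduct, Matrix.mulVec, Finset.mul_sum]
  exact Finset.sum_congr rfl fun i _ => Finset.sum_congr rfl fun j _ => by ring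

/-- **The window as Laplacian ↔ signless Laplacian — PROVED.** For an entrywise nonnegative
symmetric `W` and `|Δ| ≤ 1`, `diag(W 1) - Δ W` is positive semidefinite:
`vᵀ(diag(W1) - ΔW)v = ½ Σ_{x,y} W_{xy} (v_x² + v_y² - 2Δ v_x v_y)
 = ½ Σ_{x,y} W_{xy} [((1-Δ)/2)(v_x+v_y)² + ((1+Δ)/2)(v_x-v_y)²] ≥ 0`. -/
theorem window_psd (W : Matrix n n ℝ) (hW : W.IsSymm) (hW0 : ∀ x y, 0 ≤ W x y)
    (Δ : ℝ) (hΔ : |Δ| ≤ 1) (v : n → ℝ) :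
    0 ≤ v ⬝ᵥ ((Matrix.diagonal (W *ᵥ 1) - Δ • W) *ᵥ v) := by
  have hΔ1 : 0 ≤ 1 - Δ := by linarith [(abs_le.mp hΔ).2]
  have hΔ2 : 0 ≤ 1 + Δ := by linarith [(abs_le.mp hΔ).1]
  set S : ℝ := ∑ i, ∑ j, W i j * (v i * v i - Δ * (v i * v j)) with hSdef
  have key : v ⬝ᵥ ((Matrix.diagonal (W *ᵥ 1) - Δ • W) *ᵥ v) = S := by
    rw [dot_mulVec_eq_sum, hSdef]
    refine Finset.sum_congr rfl fun i _ => ?_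
    have hd : (W *ᵥ (1 : n → ℝ)) i = ∑ j, W i j := by
      simp [Matrix.mulVec, dotProduct]
    have h1 : ∀ j, (Matrix.diagonal (W *ᵥ 1) - Δ • W) i j * (v i * v j)
        = (if i = j then (∑ k, W i k) * (v i * v j) else 0) - Δ * W i j * (v i * v j) := by
      intro j
      rw [Matrix.sub_apply, Matrix.smul_apply, Matrix.diagonal_apply, hd, smul_eq_mul]
      split_ifs <;> ring
    simp_rw [h1]
    rw [Finset.sum_sub_distrib, Finset.sum_ite_eq, if_pos (Finset.mem_univ i), Finset.sum_mul,
      ← Finset.sum_sub_distrib]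
    exact Finset.sum_congr rfl fun j _ => by ring
  -- symmetrisation
  have hS' : S = ∑ i, ∑ j, W i j * (v j * v j - Δ * (v i * v j)) := by
    rw [hSdef, Finset.sum_comm]
    refine Finset.sum_congr rfl fun i _ => Finset.sum_congr rfl fun j _ => ?_
    rw [hW.apply i j]; ring
  have h2S : S + S = ∑ i, ∑ j, W i j * ((1 - Δ) / 2 * (v i + v j) ^ 2 + (1 + Δ) / 2 * (v i - v j) ^ 2) := by
    calc S + S = (∑ i, ∑ j, W i j * (v i * v i - Δ * (v i * v j)))
          + ∑ i, ∑ j, W i j * (v j * v j - Δ * (v i * v j)) := by rw [← hS', ← hSdef]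
      _ = ∑ i, ∑ j, W i j * ((1 - Δ) / 2 * (v i + v j) ^ 2 + (1 + Δ) / 2 * (v i - v j) ^ 2) := by
          rw [← Finset.sum_add_distrib]
          refine Finset.sum_congr rfl fun i _ => ?_
          rw [← Finset.sum_add_distrib]
          exact Finset.sum_congr rfl fun j _ => by ring
  have hnn : 0 ≤ S + S := by
    rw [h2S]
    exact Finset.sum_nonneg fun i _ => Finset.sum_nonneg fun j _ =>
      mul_nonneg (hW0 i j) (by positivity)
  rw [key]; linarith

/-- **Lyapunov identity for two hard-core bosons.** If the symmetric zero-diagonal `K` satisfies the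
two-particle eigen-equation of `H = xxzHamiltonian 1 G (-1) Δ + Σ μ_x S³_x` written on pairs
(`A` the adjacency matrix, `u_x = Δ deg(x)/2 + μ_x` the one-body potential, `C₀` the constant,
`E` the eigenvalue): for `x ≠ y`,
`E K_{xy} = -½ (AK + KA)_{xy} + (u_x + u_y) K_{xy} - Δ A_{xy} K_{xy} + C₀ K_{xy}`,
then with `B = -½A + diag u + ((C₀ - E)/2)·1` one has `BK + KB = Δ (A ⊙ K) - diag((A ⊙ K) 1)`. -/
theorem lyapunovIdentity_N2 (A K : Matrix n n ℝ) (u : n → ℝ) (Δ C₀ E : ℝ)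
    (hK0 : ∀ x, K x x = 0)
    (heig : ∀ x y, x ≠ y →
      E * K x y = -(1/2) * ((A * K) x y + (K * A) x y) + (u x + u y) * K x y - Δ * A x y * K x y + C₀ * K x y) :
    let B : Matrix n n ℝ := -(1/2 : ℝ) • A + Matrix.diagonal u + ((C₀ - E) / 2) • 1
    B * K + K * B = Δ • (A ⊙ K) - Matrix.diagonal ((A ⊙ K) *ᵥ 1) := by
  sorry

/-- **Inertia compression.** If `B K + K B = -Q` with `Q ⪰ 0` (all real symmetric) then `B` is
negative semidefinite on every `K`-invariant subspace on which `K` is positive definite; stated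
for the span of a finite family of `K`-eigenvectors with positive eigenvalues: hence the positive
index of `K` is at most the number of nonpositive directions of `B` (for two hard-core bosons,
`B = h - Ẽ/2` with `h` the one-particle Hamiltonian, so `π(K) ≤ #{k : 2ε_k(h) ≤ Ẽ}`, which is `1`
as soon as `Ẽ < 2 ε₂(h)` — automatic for `0 ≤ Δ ≤ 1` by the `|Slater|` trial state). -/
theorem inertia_compression (B K Q : Matrix n n ℝ) (hB : B.IsSymm) (hK : K.IsSymm)
    (hQ : ∀ v : n → ℝ, 0 ≤ v ⬝ᵥ (Q *ᵥ v)) (hLyap : B * K + K * B = -Q)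
    {s : Type} [Fintype s] (e : s → (n → ℝ)) (κ : s → ℝ) (hκ : ∀ i, 0 < κ i)
    (he : ∀ i, K *ᵥ e i = κ i • e i) (c : s → ℝ) :
    (∑ i, c i • e i) ⬝ᵥ (B *ᵥ (∑ i, c i • e i)) ≤ 0 := by
  sorry

/-- **Doob / ground-state representation of the one-body gap (statement).** For a real symmetric
`h` with nonpositive off-diagonal entries `h x y = -(1/2) A x y` (`A ≥ 0`), a positive vector `φ₁`
with `h φ₁ = ε₁ φ₁`, and any `φ₂` with `h φ₂ = ε₂ φ₂`, `⟨φ₁,φ₂⟩ = 0`, `‖φ₂‖ = 1`: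
`ε₂ - ε₁ = ½ Σ_{x,y} (A x y / 2) · f(x,y)² / (φ₁ x · φ₁ y)` with the Slater amplitude
`f(x,y) = φ₁ x · φ₂ y - φ₂ x · φ₁ y` (sum over ordered pairs, each unordered edge twice).
Since `φ₁ x · φ₁ y ≤ ½ ‖φ₁‖² = ½`, this gives the WINDOW INEQUALITY
`|Δ| · Σ_{x<y, x∼y} f(x,y)² ≤ ε₂ - ε₁` for every `|Δ| ≤ 1` — the interaction energy of the trial state
`|f|` is dominated by the one-body gap, whence `Ẽ₂ ≤ ε₁ + ε₂ + |Δ| Σ_{x∼y} f² ≤ 2 ε₂`. -/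
theorem gap_eq_doobForm (A : Matrix n n ℝ) (hA : A.IsSymm) (u φ₁ φ₂ : n → ℝ) (ε₁ ε₂ : ℝ)
    (hφ₁ : ∀ x, 0 < φ₁ x) (hnorm₁ : φ₁ ⬝ᵥ φ₁ = 1) (hnorm₂ : φ₂ ⬝ᵥ φ₂ = 1) (horth : φ₁ ⬝ᵥ φ₂ = 0)
    (h₁ : (-(1/2 : ℝ) • A + Matrix.diagonal u) *ᵥ φ₁ = ε₁ • φ₁)
    (h₂ : (-(1/2 : ℝ) • A + Matrix.diagonal u) *ᵥ φ₂ = ε₂ • φ₂) :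
    ε₂ - ε₁ = (1/4 : ℝ) * ∑ x, ∑ y, A x y * (φ₁ x * φ₂ y - φ₂ x * φ₁ y) ^ 2 / (φ₁ x * φ₁ y) := by
  sorry

/-- **Two-particle spectral sandwich (statement; the N = 2 theorem's analytic input).** For the
hard-core two-particle sector of `H = xxzHamiltonian 1 G (-1) Δ + Σ μ_x S³_x` on a connected graph
with at least three vertices and `|Δ| ≤ 1`, the reduced ground energy `Ẽ₂` lies strictly below twice
the second one-body level: `Ẽ₂ < 2 ε₂(h)`, `h = -½A + diag(Δ deg/2 + μ)`.  Written abstractly: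
if `K ≥ 0` symmetric zero-diagonal solves the pair eigen-equation (as in `lyapunovIdentity_N2`) with
the LOWEST pair energy `E`, then `E - C₀ < 2 ε₂`.  Proof route: variational state `|φ₁ ∧ φ₂|`
(diamagnetic inequality for the hopping part, `gap_eq_doobForm` for the interaction part). -/
def TwoParticleSandwich : Prop :=
  ∀ (n : Type) [Fintype n] [DecidableEq n] (A : Matrix n n ℝ), A.IsSymm → (∀ x y, A x y = 0 ∨ A x y = 1) →
    (∀ x, A x x = 0) → 3 ≤ Fintype.card n →
    ∀ (u : n → ℝ) (Δ : ℝ), |Δ| ≤ 1 →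
    ∀ (φ₁ φ₂ : n → ℝ) (ε₁ ε₂ : ℝ), (∀ x, 0 < φ₁ x) → φ₂ ≠ 0 → φ₁ ⬝ᵥ φ₂ = 0 →
      (-(1/2 : ℝ) • A + Matrix.diagonal u) *ᵥ φ₁ = ε₁ • φ₁ →
      (-(1/2 : ℝ) • A + Matrix.diagonal u) *ᵥ φ₂ = ε₂ • φ₂ →
      (∀ (φ : n → ℝ) (ε : ℝ), φ ≠ 0 → φ ⬝ᵥ φ₁ = 0 →
        (-(1/2 : ℝ) • A + Matrix.diagonal u) *ᵥ φ = ε • φ → ε₂ ≤ ε) →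
    ∀ (K : Matrix n n ℝ) (E : ℝ), K.IsSymm → (∀ x, K x x = 0) → (∀ x y, 0 ≤ K x y) → K ≠ 0 →
      (∀ x y, x ≠ y → E * K x y = -(1/2) * ((A * K) x y + (K * A) x y) + (u x + u y) * K x y - Δ * A x y * K x y) →
      (∀ (K' : Matrix n n ℝ) (E' : ℝ), K'.IsSymm → (∀ x, K' x x = 0) → K' ≠ 0 →
        (∀ x y, x ≠ y → E' * K' x y = -(1/2) * ((A * K') x y + (K' * A) x y) + (u x + u y) * K' x y - Δ * A x y * K' x y) → E ≤ E') →
      E < 2 * ε₂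

end Inertia

end Summit.AtomisticToContinuum.BoseEinsteinCondensation.Cruxes.GroundStateStability.IdeatorK3
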